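import Literature.Geometry.Kaehler.ComplexTorusQuaternionMultiplicationAbelian
import Literature.Geometry.Kaehler.ComplexTorusAbelianSurfaceShimura
import HarnessLib

/-!
# Simple complex tori of dimension 2 with quaternion multiplication: Picard number `3`, `End_ℚ(X) = ι(Q)`,
# Albert type II — with NO polarization hypothesis (Lang 1982 IX §4 + Hulek–Laface 2019 Prop. 5.1 (4))

Layer `Literature/Geometry/Kaehler`, namespaces `Literature.Geometry.Kaehler.ComplexTorus.QuaternionType` (§1) and
`…ComplexTorus` (§2–§3, dot notation on `IsSimple`); lane
`lit-hodgefound` (Track 2 foundations library), seat p12 gen 13, row g13-#4 (sequel of g13-#2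
`ComplexTorusQuaternionMultiplicationAbelian`). THEOREMS ONLY (no definition, no named fact).

## What is printed, and what the tree had

The tree's classification of the endomorphism algebra of a SIMPLE ABELIAN surface
(`ComplexTorusAbelianSurfaceEndomorphismAlgebras`, `ComplexTorusAbelianSurfaceShimura`: Lange 2023 §2.6,
Hulek–Laface 2019 Prop. 5.1) is stated for a simple complex torus `X` of dimension `2` TOGETHER WITH a Riemann
form `η` (a polarization): e.g. `IsSimple.finrank_neronSeveriGroup_eq_three_of_mul_self_eq_smul` — «if
`End_ℚ(X)` contains a totally indefinite quaternion algebra» (witnessed by `W ∈ End_ℚ(X)`, `W² = q < 0`) then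
`ρ(X) = 3` and the Rosati pair is of Albert type II (Hulek–Laface, Prop. 5.1, case (4)). By Lang's «a torus as
above is always abelian» (Ch. IX §4, p. 102 L25; the tree's `isAbelianVariety_of_quaternionAlgebra`, g13-#2) the
polarization comes for free from the quaternion multiplication, so for a simple complex torus `X = E/Φ(ℤ^κ)` of
dimension `2` with `f : Q = (a, b)_ℚ →ₐ[ℚ] M_κ(ℚ)`, `f(Q) ⊆ End_ℚ(X)`, `Q` a division algebra, `a ≠ 0 < b`:

* `exists_mul_self_eq_algebraMap_neg` — `Q` contains `γ` with `γ² = q ∈ ℚ_{<0}` (`γ = i` if `a < 0`, `γ = ij`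
  if `a > 0`; «given an element `γ ∈ Q`, `γ² ∈ ℚ`, and `γ² < 0`»); `map_mul_self_eq_smul_one` (`f(γ)² = q · 1`);
  `injective_of_forall_isUnit` (`ι` is an embedding).
* **`IsSimple.finrank_neronSeveriGroup_eq_three_of_quaternionAlgebra`** — `ρ(X) = 3`.
* **`IsSimple.isAlbertTypeII_of_quaternionAlgebra`** — for EVERY Riemann form of `X` (with rational Gram matrix
  `G`) the Rosati pair `(End_ℚ(X), ′)` is of Albert type II over the centre.
* **`IsSimple.finrank_endAlgRat_eq_four_of_quaternionAlgebra`** — `dim_ℚ End_ℚ(X) = 4`, and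
  **`IsSimple.exists_eq_of_mem_endAlgRat`** — `End_ℚ(X) = ι(Q)`: every element of `End_ℚ(X)` is `f(α)`.
* Non-vacuity: `finrank_neronSeveriGroup_period_neg_one_three_of_isSimple` (p28's `A(τ)` over `(−1, 3)_ℚ`, if
  simple, has `ρ = 3`).

## Scope, in numbers (what is NOT asserted)

Simplicity is a hypothesis: a non-simple `2`-torus may carry quaternion multiplication too (`E₀ × E₀` with `E₀`
CM has `End_ℚ = M₂(K) ⊇` many quaternion algebras), and nothing is said about that case. Division hypothesis
`hQ` and fixed splitting `ρ` as in g13-#1/#2.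

## References

* [Lang1982AbelianFunctions] S. Lang, *Introduction to Algebraic and Abelian Functions*, 2nd ed., GTM 89,
  Springer (1982), Ch. IX §4, p. 102 L25 and Thm. 4.3 (p. 103 L28–L36).
* [HulekLaface2019PicardNumbersAV] K. Hulek, R. Laface, *On the Picard numbers of abelian varieties*, Ann.
  Sc. Norm. Super. Pisa (2019), §5.1 Prop. 5.1, exceptional case (4) («`End_ℚ(X)` contains a totally
  indefinite quaternion algebra») — used BY NAME through `IsSimple.finrank_neronSeveriGroup_eq_three_of_mul_self_eq_smul`.
* [Lange2023AbelianVarietiesComplex] H. Lange, *Abelian Varieties over the Complex Numbers* (2023), §2.6.1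
  Proposition (table: type II, `ρ = 3e`, `[F : ℚ] = 4e`) and §2.6.2 Thm. 2.6.5 — used BY NAME through
  `IsSimple.finrank_neronSeveriGroup_and_finrank_endAlgRat_of_finrank_eq_two`.
-/

noncomputable section

open Module Matrix Quaternion
open Literature.RingTheory.CentralSimple

namespace Literature.Geometry.Kaehler

namespace ComplexTorus

/-! ## §1 The skew element `γ` and the embedding `ι` -/

namespace QuaternionType

section Algebra

variable {a b : ℤ}

/-- **«Given an element `γ ∈ Q`, `γ² ∈ ℚ`, and `γ² < 0`» — such an element exists in every indefinite
`(a, b)_ℚ` with `b > 0`**: `γ = i` (`i² = a`) if `a < 0`, `γ = ij` (`(ij)² = −ab`) if `a > 0`.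
[cite: Lang1982AbelianFunctions, Ch. IX §4 Thm. 4.3 (p. 103 L32) and §2 Thm. 2.3] -/
theorem exists_mul_self_eq_algebraMap_neg (ha : a ≠ 0) (hb : 0 < b) :
    ∃ (γ : ℍ[ℚ,(a : ℚ),(b : ℚ)]) (q : ℚ), γ * γ = algebraMap ℚ _ q ∧ q < 0 := by
  rcases lt_or_gt_of_ne ha with ha' | ha'
  · refine ⟨⟨0, 1, 0, 0⟩, a, ?_, Int.cast_lt_zero.2 ha'⟩
    rw [QuaternionAlgebra.algebraMap_eq]; ext <;> simp
  · refine ⟨⟨0, 0, 0, 1⟩, -((a : ℚ) * b), ?_, neg_neg_of_pos (mul_pos (Int.cast_pos.2 ha') (Int.cast_pos.2 hb))⟩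
    rw [QuaternionAlgebra.algebraMap_eq]; ext <;> simp

variable {κ : Type*} [Fintype κ] [DecidableEq κ] (f : ℍ[ℚ,(a : ℚ),(b : ℚ)] →ₐ[ℚ] Matrix κ κ ℚ)

/-- `f(γ)² = q · 1` for `γ² = q`. [cite: Lang1982AbelianFunctions, Ch. IX §4 Thm. 4.3] -/
theorem map_mul_self_eq_smul_one {γ : ℍ[ℚ,(a : ℚ),(b : ℚ)]} {q : ℚ} (hγ : γ * γ = algebraMap ℚ _ q) :
    f γ * f γ = q • (1 : Matrix κ κ ℚ) := by
  rw [← map_mul, hγ, AlgHom.commutes, Algebra.algebraMap_eq_smul_one]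

/-- **`ι : Q → End_ℚ(X)` is injective** for a division algebra `Q` and a non-empty index type («an embedding»).
[cite: Lang1982AbelianFunctions, Ch. IX §4 (p. 101 L33: «`ι : Q → End(A)_ℚ` be an embedding»)] -/
theorem injective_of_forall_isUnit [Nonempty κ] (hQ : ∀ x : ℍ[ℚ,(a : ℚ),(b : ℚ)], x ≠ 0 → IsUnit x) :
    Function.Injective f := by
  rw [injective_iff_map_eq_zero]
  intro α hα
  by_contra hne
  obtain ⟨u, rfl⟩ := hQ α hne
  have h1 : f 1 = 0 := by
    rw [← u.inv_mul, map_mul, hα, mul_zero]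
  exact one_ne_zero ((map_one f).symm.trans h1)

end Algebra

end QuaternionType

/-! ## §2 Simple `2`-tori with quaternion multiplication -/

section Simple

open QuaternionType

variable {κ : Type} [Fintype κ] [DecidableEq κ] [Nonempty κ] {E : Type*} [NormedAddCommGroup E]
  [NormedSpace ℂ E] [FiniteDimensional ℂ E] {Φ : (κ → ℝ) ≃L[ℝ] E} {a b : ℤ}
  (f : ℍ[ℚ,(a : ℚ),(b : ℚ)] →ₐ[ℚ] Matrix κ κ ℚ) (hf : ∀ α, f α ∈ endAlgRat Φ)

include hf in
/-- **A SIMPLE complex torus of dimension `2` with multiplication by an indefinite division quaternion algebra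
has Picard number `ρ(X) = 3`** — Hulek–Laface's case (4) («`End_ℚ(X)` contains a totally indefinite
quaternion algebra») with the polarization supplied by Lang's «a torus as above is always abelian»
(`isAbelianVariety_of_quaternionAlgebra`): `W = f(γ)`, `γ² = q < 0`, has `W² = q·1`.
[cite: HulekLaface2019PicardNumbersAV, §5.1 Prop. 5.1, case (4)] [cite: Lang1982AbelianFunctions, Ch. IX §4 p. 102 L25] -/
theorem IsSimple.finrank_neronSeveriGroup_eq_three_of_quaternionAlgebra (hX : IsSimple Φ)
    (hE : finrank ℂ E = 2) (ha : a ≠ 0) (hb : 0 < b) (hQ : ∀ x : ℍ[ℚ,(a : ℚ),(b : ℚ)], x ≠ 0 → IsUnit x) :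
    finrank ℤ (neronSeveriGroup Φ) = 3 := by
  obtain ⟨η, hη⟩ := isAbelianVariety_of_quaternionAlgebra Φ f hf hE ha hb hQ
  obtain ⟨G, hG⟩ := hη.exists_ratMatrix_latticeGram
  obtain ⟨γ, q, hγ, hq⟩ := exists_mul_self_eq_algebraMap_neg ha hb
  exact (hX.finrank_neronSeveriGroup_eq_three_of_mul_self_eq_smul hη hG hE (hf γ) hq
    (map_mul_self_eq_smul_one f hγ)).1

include hf in
/-- **… and every polarization of it is of Albert type II**: for EVERY Riemann form `η` of `X` with rational
Gram matrix `G`, the pair `(End_ℚ(X), A ↦ G⁻¹ᵗAG)` is a totally indefinite quaternion algebra with positive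
involution of the first kind over its centre (here `Q` need not be a division algebra: only `W = f(γ)`,
`W² = q·1`, `q < 0`, is used). [cite: HulekLaface2019PicardNumbersAV, §5.1 Prop. 5.1, case (4)] [cite: Lange2023AbelianVarietiesComplex, §2.6.1 Proposition (table, type II)] -/
theorem IsSimple.isAlbertTypeII_of_quaternionAlgebra (hX : IsSimple Φ) (hE : finrank ℂ E = 2) (ha : a ≠ 0)
    (hb : 0 < b) {η : E [⋀^Fin 2]→L[ℝ] ℝ} (hη : IsRiemannForm Φ η) {G : Matrix κ κ ℚ}
    (hG : G.map (Rat.cast : ℚ → ℝ) = latticeGram Φ η) :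
    IsAlbertTypeII (centerField Φ hX) (endAlgRat Φ) (rosatiEnd Φ hη.1 hη.2.2 hG) := by
  obtain ⟨γ, q, hγ, hq⟩ := exists_mul_self_eq_algebraMap_neg ha hb
  exact (hX.finrank_neronSeveriGroup_eq_three_of_mul_self_eq_smul hη hG hE (hf γ) hq
    (map_mul_self_eq_smul_one f hγ)).2

include hf in
/-- **`dim_ℚ End_ℚ(X) = 4`** for a simple `2`-torus with indefinite division quaternion multiplication (the type II
line of the table: `[F : ℚ] = 4e`, `e = 1`). [cite: Lange2023AbelianVarietiesComplex, §2.6.1 Proposition (table) and §2.6.2 Thm. 2.6.5] [cite: HulekLaface2019PicardNumbersAV, §5.1 Prop. 5.1, case (4)] -/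
theorem IsSimple.finrank_endAlgRat_eq_four_of_quaternionAlgebra (hX : IsSimple Φ) (hE : finrank ℂ E = 2)
    (ha : a ≠ 0) (hb : 0 < b) (hQ : ∀ x : ℍ[ℚ,(a : ℚ),(b : ℚ)], x ≠ 0 → IsUnit x) :
    finrank ℚ (endAlgRat Φ) = 4 := by
  have h3 := hX.finrank_neronSeveriGroup_eq_three_of_quaternionAlgebra f hf hE ha hb hQ
  obtain ⟨η, hη⟩ := isAbelianVariety_of_quaternionAlgebra Φ f hf hE ha hb hQ
  rcases hX.finrank_neronSeveriGroup_and_finrank_endAlgRat_of_finrank_eq_two hη hE with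
    ⟨h, -⟩ | ⟨h, -⟩ | ⟨-, h⟩ | ⟨h, -⟩ <;> omega

include hf in
/-- **`End_ℚ(X) = ι(Q)`**: on a simple `2`-torus with indefinite division quaternion multiplication every
endomorphism (tensor `ℚ`) is multiplication by an element of `Q` — `f(Q) ⊆ End_ℚ(X)`, both of `ℚ`-dimension `4`,
`f` injective. [cite: Lange2023AbelianVarietiesComplex, §2.6.1 Proposition (table, type II: `End_ℚ(X) = F`)] [cite: HulekLaface2019PicardNumbersAV, §5.1 Prop. 5.1, case (4)] -/
theorem IsSimple.exists_eq_of_mem_endAlgRat (hX : IsSimple Φ) (hE : finrank ℂ E = 2) (ha : a ≠ 0)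
    (hb : 0 < b) (hQ : ∀ x : ℍ[ℚ,(a : ℚ),(b : ℚ)], x ≠ 0 → IsUnit x) {A : Matrix κ κ ℚ}
    (hA : A ∈ endAlgRat Φ) : ∃ α, f α = A := by
  -- `f(Q) ≤ End_ℚ(X)` as `ℚ`-subspaces of `M_κ(ℚ)`, both of dimension `4`
  have hle : LinearMap.range f.toLinearMap ≤ Subalgebra.toSubmodule (endAlgRat Φ) := by
    rintro _ ⟨α, rfl⟩
    exact hf α
  have hinj : Function.Injective f.toLinearMap := injective_of_forall_isUnit f hQ
  have h4 : finrank ℚ (LinearMap.range f.toLinearMap) = finrank ℚ (Subalgebra.toSubmodule (endAlgRat Φ)) := by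
    rw [LinearMap.finrank_range_of_inj hinj, QuaternionAlgebra.finrank_eq_four, Subalgebra.finrank_toSubmodule,
      hX.finrank_endAlgRat_eq_four_of_quaternionAlgebra f hf hE ha hb hQ]
  have heq := Submodule.eq_of_le_of_finrank_eq hle h4
  have hA' : A ∈ LinearMap.range f.toLinearMap := by
    rw [heq]
    exact hA
  obtain ⟨α, hα⟩ := hA'
  exact ⟨α, hα⟩

end Simple

/-! ## §3 Non-vacuity of the hypotheses: p28's `A(τ)` over `(−1, 3)_ℚ` -/

section Validation

open QuaternionType

variable {τ : ℂ}

/-- If p28's `A(τ) = ℂ²/ρ(𝔬)(τ, 1)ᵗ` over the skew field `(−1, 3)_ℚ` is simple, then `ρ(A(τ)) = 3` — the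
hypotheses `hf`, `hQ`, `hE` of §2 instantiated (`ι = endHom`). [cite: HulekLaface2019PicardNumbersAV, §5.1 Prop. 5.1, case (4)] [cite: Lang1982AbelianFunctions, Ch. IX §4 p. 102 L25] -/
theorem finrank_neronSeveriGroup_period_neg_one_three_of_isSimple (hτ : τ.im ≠ 0)
    (hX : IsSimple (period (-1) 3 (by norm_num) (by norm_num) hτ)) :
    finrank ℤ (neronSeveriGroup (period (-1) 3 (by norm_num) (by norm_num) hτ)) = 3 :=
  hX.finrank_neronSeveriGroup_eq_three_of_quaternionAlgebra (lmul (-1) 3)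
    (lmul_mem_endAlgRat (by norm_num) (by norm_num) hτ) (Module.finrank_fin_fun ℂ) (by norm_num) (by norm_num)
    (by exact_mod_cast Literature.RingTheory.CentralSimple.forall_isUnit_quaternionAlgebra_neg_one_three)

end Validation

end ComplexTorus

end Literature.Geometry.Kaehler
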